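import Summits.ABC.ABC.Theses.CongruentialReceptacle
import Summits.ABC.ABC.Theorems.CongruentialReceptacleQuarterWindowGivesCrux
import Summits.ABC.ABC.Theorems.CongruentialReceptacleAssembly
import Literature.NumberTheory.DiophantineGeometry.PastenSubexpTheorem14
import HarnessLib

/-!
# Thin-window rigidity: transport of the logarithmic abc bound along the fold

Stub `stub_thinWindowFold` of the line `Descent` (card `balance-window-descent`) for the crux
stmt-ABC-1723 `BalancedFreySzpiro` (Szpiro `6+ε` for the Frey curves of balanced abc triples).

The line transports the logarithmic abc bound `log c ≤ K' + (1+e) · log rad(abc)` along maps of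
abc triples acting on the balance coordinate `t = a/c`. This file is the transport along the
*fold* `F`, which comes from the identity `(a-b)² + 4ab = (a+b)² = c²`. For an abc triple with
`b < a` put `d = a - b ≥ 1`; then

* if `c` is odd, `(A, B, C) = (d², 4ab, c²)` is an abc triple (`d` is odd and coprime to `a`, `b`);
* if `c` is even, `d` is even too (`d = 2a - c`) and `(A, B, C) = ((d/2)², ab, (c/2)²)` is an abc
  triple.

In both cases `A · c² = C · d²`, so the balance coordinate of the new triple is
`A/C = (d/c)² = (2t - 1)² = (1 - 2t)²`; its top satisfies `c² ≤ 4C`, i.e. `log C ≥ 2 log c - 2 log 2`;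
and `A · B · C` divides `(2d · abc)²` resp. `((d/2) · abc)²`, so `rad(ABC) ≤ 2d · rad(abc) ≤ 2c · rad(abc)`
(`thinWindowFold_rad_le_of_dvd`, the pattern of `rad_split_le`). Hence the bound at exponent `δ` on
`T`, applied to `(A, B, C)`, reads `2 log c - 2 log 2 ≤ K' + (1+δ)(log 2 + log c + log rad(abc))`,
i.e. `log c ≤ (K' + (3+δ) log 2)/(1-δ) + ((1+δ)/(1-δ)) · log rad(abc)`. With `δ = ε/(2+ε)` one has
`(1+δ)/(1-δ) = 1 + ε` exactly and, for `K' ≥ 0`, `0 < ε ≤ 1` (so `δ ≤ 1/3`), the constant is at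
most `2K' + 5` (`Real.log_two_lt_d9`). The case `a < b` follows by the symmetry `a ↔ b`
(`IsABCTriple.swap`, `rad_swap`; `(1 - 2(1-t))² = (1-2t)²`), and `a = b` is excluded by `t ≠ 1/2`.
-/

-- `Summit.<Summit>.<Problem>` is the mandated summit-side namespace (CONVENTIONS §2); for the
-- single-conjunct summit `ABC` the two coincide, so the duplicate `ABC.ABC` is deliberate.
set_option linter.dupNamespace false

noncomputable section

open Real UniqueFactorizationMonoid
open Literature.NumberTheory.DiophantineGeometry
open Summit.ABC.ABC.Theses.CongruentialReceptacle

namespace Summit.ABC.ABC.Theorems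

/-! ### The fold triple at the level of `ℕ` -/

/-- The fold identity: if `a = b + d` and `c = a + b` then `d² + 4ab = c²`. [folklore] -/
theorem thinWindowFold_sq {a b c d : ℕ} (hd : b + d = a) (habc : a + b = c) :
    d ^ 2 + 4 * (a * b) = c ^ 2 := by
  subst hd habc
  ring

/-- If `gcd(a, b) = 1` and `a = b + d` then `gcd(d, ab) = 1`. [folklore] -/
theorem thinWindowFold_coprime {a b d : ℕ} (hcop : Nat.Coprime a b) (hd : b + d = a) :
    Nat.Coprime d (a * b) := by
  subst hd
  have hdb : Nat.Coprime d b := Nat.coprime_self_add_left.mp hcop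
  exact Nat.Coprime.mul_right (Nat.coprime_add_self_right.mpr hdb) hdb

/-- Radical bookkeeping: if `A · B · C` divides `(m · abc)²` (`m, abc ≠ 0`) then
`rad(ABC) ≤ m · rad(abc)`, because `rad((m·abc)²) = rad(m·abc)` divides `rad(m) · rad(abc)` and
`rad(m) ≤ m`. [folklore] -/
theorem thinWindowFold_rad_le_of_dvd {A B C a b c m : ℕ} (hm : m ≠ 0) (h0 : a * b * c ≠ 0)
    (hdvd : A * B * C ∣ (m * (a * b * c)) ^ 2) : rad A B C ≤ m * rad a b c := by
  rw [rad_def, rad_def]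
  have hne : (m * (a * b * c)) ^ 2 ≠ 0 := pow_ne_zero _ (mul_ne_zero hm h0)
  have h1 : radical (A * B * C) ∣ radical (m * (a * b * c)) := by
    have h := radical_dvd_radical hdvd hne
    rwa [radical_pow _ two_ne_zero] at h
  have h2 : radical (m * (a * b * c)) ∣ radical m * radical (a * b * c) := radical_mul_dvd
  have h3 : radical m ≤ m := Nat.radical_le_self_iff.mpr hm
  calc radical (A * B * C)
      ≤ radical m * radical (a * b * c) :=
        Nat.le_of_dvd (Nat.mul_pos (Nat.radical_pos _) (Nat.radical_pos _)) (h1.trans h2)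
    _ ≤ m * radical (a * b * c) := Nat.mul_le_mul_right _ h3

/-- The fold triple for `c` odd: if `(a, b, c)` is an abc triple with `a = b + d`, `d` odd, then
`(d², 4ab, c²)` is an abc triple (`d` is coprime to `2`, `a` and `b`). [folklore] -/
theorem thinWindowFold_isABCTriple_odd {a b c d : ℕ} (h : IsABCTriple a b c) (hd : b + d = a)
    (hodd : d % 2 = 1) : IsABCTriple (d ^ 2) (4 * (a * b)) (c ^ 2) := by
  obtain ⟨ha, hb, habc, hcop⟩ := h
  have hd0 : 0 < d := by omega
  refine ⟨pow_pos hd0 2, Nat.mul_pos (by norm_num) (Nat.mul_pos ha hb), thinWindowFold_sq hd habc,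
    ?_⟩
  have h2 : Nat.Coprime d 2 := Nat.coprime_two_right.mpr (Nat.odd_iff.mpr hodd)
  have h4 : Nat.Coprime d 4 := by
    rw [show (4 : ℕ) = 2 ^ 2 by norm_num]
    exact Nat.Coprime.pow_right 2 h2
  exact Nat.Coprime.pow_left 2 (Nat.Coprime.mul_right h4 (thinWindowFold_coprime hcop hd))

/-- The fold triple for `c` even: if `(a, b, c)` is an abc triple with `a = b + d`, `d = 2d' > 0`,
`c = 2c'`, then `(d'², ab, c'²)` is an abc triple (`4d'² + 4ab = 4c'²`, and `d' ∣ d` is coprime to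
`a` and `b`). [folklore] -/
theorem thinWindowFold_isABCTriple_even {a b c d c' d' : ℕ} (h : IsABCTriple a b c)
    (hd : b + d = a) (hc' : c = 2 * c') (hd' : d = 2 * d') (hd0 : 0 < d) :
    IsABCTriple (d' ^ 2) (a * b) (c' ^ 2) := by
  obtain ⟨ha, hb, habc, hcop⟩ := h
  have hd'0 : 0 < d' := by omega
  refine ⟨pow_pos hd'0 2, Nat.mul_pos ha hb, ?_, ?_⟩
  · have key : d ^ 2 + 4 * (a * b) = c ^ 2 := thinWindowFold_sq hd habc
    rw [hc', hd'] at key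
    have h4 : 4 * (d' ^ 2 + a * b) = 4 * c' ^ 2 := by
      calc 4 * (d' ^ 2 + a * b) = (2 * d') ^ 2 + 4 * (a * b) := by ring
        _ = (2 * c') ^ 2 := key
        _ = 4 * c' ^ 2 := by ring
    exact Nat.eq_of_mul_eq_mul_left (by norm_num) h4
  · have hdab : Nat.Coprime d (a * b) := thinWindowFold_coprime hcop hd
    exact Nat.Coprime.pow_left 2 (hdab.coprime_dvd_left ⟨2, by omega⟩)

/-- **The fold data.** For an abc triple `(a, b, c)` with `a = b + d`, `d > 0`, there is an abc
triple `(A, B, C)` with `A · c² = C · d²` (balance coordinate `(d/c)²`), `c² ≤ 4C` and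
`rad(ABC) ≤ 2c · rad(abc)`: `(d², 4ab, c²)` if `c` is odd, `((d/2)², ab, (c/2)²)` if `c` is even
(then `d = 2a - c` is even too). [folklore] -/
theorem thinWindowFold_data {a b c d : ℕ} (h : IsABCTriple a b c) (hd : b + d = a) (hd0 : 0 < d) :
    ∃ A B C : ℕ, IsABCTriple A B C ∧ A * c ^ 2 = C * d ^ 2 ∧ c ^ 2 ≤ 4 * C ∧
      rad A B C ≤ 2 * c * rad a b c := by
  obtain ⟨ha, hb, habc, -⟩ := id h
  have h0 : a * b * c ≠ 0 := Nat.mul_ne_zero (Nat.mul_ne_zero ha.ne' hb.ne') (by omega)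
  obtain ⟨k, hk | hk⟩ := Nat.even_or_odd' c
  · -- `c = 2k` is even, hence so is `d = 2a - c`
    obtain ⟨d', hd'⟩ : ∃ d', d = 2 * d' := ⟨a - k, by omega⟩
    refine ⟨d' ^ 2, a * b, k ^ 2, thinWindowFold_isABCTriple_even h hd hk hd' hd0, ?_, ?_, ?_⟩
    · rw [hk, hd']
      ring
    · rw [hk]
      exact le_of_eq (by ring)
    · have h1 : rad (d' ^ 2) (a * b) (k ^ 2) ≤ d' * rad a b c :=
        thinWindowFold_rad_le_of_dvd (by omega) h0 ⟨4 * (a * b), by rw [hk]; ring⟩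
      exact h1.trans (Nat.mul_le_mul_right _ (by omega))
  · -- `c = 2k + 1` is odd, hence so is `d = 2a - c`
    have hodd : d % 2 = 1 := by omega
    refine ⟨d ^ 2, 4 * (a * b), c ^ 2, thinWindowFold_isABCTriple_odd h hd hodd, by ring,
      Nat.le_mul_of_pos_left _ (by norm_num), ?_⟩
    have h1 : rad (d ^ 2) (4 * (a * b)) (c ^ 2) ≤ 2 * d * rad a b c :=
      thinWindowFold_rad_le_of_dvd (by omega) h0 ⟨a * b, by ring⟩
    exact h1.trans (Nat.mul_le_mul_right _ (by omega))

/-! ### The logarithmic bookkeeping -/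

/-- **Transport along an abstract fold datum.** If the logarithmic abc bound at exponent
`δ = ε/(2+ε)` with constant `K' ≥ 0` holds on `T`, `(a, b, c)` is an abc triple with `a = b + d` and
`(1 - 2a/c)² ∈ T`, and `(A, B, C)` is an abc triple with `A · c² = C · d²`, `c² ≤ 4C`,
`rad(ABC) ≤ 2c · rad(abc)`, then `log c ≤ 2K' + 5 + (1+ε) · log rad(abc)`: the coordinate of
`(A, B, C)` is `(d/c)² = (1 - 2a/c)²`, so the hypothesis gives
`2 log c - 2 log 2 ≤ log C ≤ K' + (1+δ)(log 2 + log c + log rad(abc))`; divide by `1 - δ > 0` and use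
`(1+δ)/(1-δ) = 1 + ε`, `(K' + (3+δ) log 2)/(1-δ) ≤ 2K' + 5`. [folklore] -/
theorem thinWindowFold_of_data {T : Set ℝ} {ε δ K' : ℝ} (hε : 0 < ε) (hε1 : ε ≤ 1)
    (hδ : δ = ε / (2 + ε)) (hK' : 0 ≤ K')
    (H : ∀ a b c : ℕ, IsABCTriple a b c → (a : ℝ) / (c : ℝ) ∈ T →
      Real.log (c : ℝ) ≤ K' + (1 + δ) * Real.log ((rad a b c : ℕ) : ℝ))
    {a b c d A B C : ℕ} (h : IsABCTriple a b c) (hd : b + d = a) (hT : IsABCTriple A B C)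
    (hcoord : A * c ^ 2 = C * d ^ 2) (hC : c ^ 2 ≤ 4 * C)
    (hrad : rad A B C ≤ 2 * c * rad a b c) (ht : (1 - 2 * ((a : ℝ) / (c : ℝ))) ^ 2 ∈ T) :
    Real.log (c : ℝ) ≤ 2 * K' + 5 + (1 + ε) * Real.log ((rad a b c : ℕ) : ℝ) := by
  -- constants: `δ = ε/(2+ε)` has `0 < δ ≤ 1/3`, `(1+δ)/(1-δ) = 1 + ε`, and the constant term
  -- `(K' + (3+δ) log 2)/(1-δ)` is at most `2K' + 5`
  have h2ε : (0 : ℝ) < 2 + ε := by positivity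
  have hδ0 : 0 < δ := by
    rw [hδ]
    positivity
  have hδ3 : δ ≤ 1 / 3 := by
    rw [hδ, div_le_iff₀ h2ε]
    linarith
  have h1m : 0 < 1 - δ := by linarith
  have h1p : 0 ≤ 1 + δ := by linarith
  have hlog2 : 0 ≤ Real.log 2 := Real.log_nonneg one_le_two
  have hratio : (1 + δ) / (1 - δ) = 1 + ε := by
    rw [div_eq_iff h1m.ne', hδ]
    field_simp
    ring
  have hconst : (K' + (3 + δ) * Real.log 2) / (1 - δ) ≤ 2 * K' + 5 := by
    rw [div_le_iff₀ h1m]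
    have h13 : 0 ≤ 1 / 3 - δ := by linarith
    nlinarith [mul_nonneg hK' h13, mul_nonneg hlog2 h13, Real.log_two_lt_d9]
  -- positivity bookkeeping
  obtain ⟨ha0, hb0, habc, -⟩ := h
  have hA0 : 0 < A := hT.1
  have hABC : A + B = C := hT.2.2.1
  have hC0 : 0 < C := by omega
  have haR : (0 : ℝ) < a := by exact_mod_cast ha0
  have hbR : (0 : ℝ) < b := by exact_mod_cast hb0
  have hcR : (c : ℝ) = a + b := by exact_mod_cast habc.symm
  have hcpos : (0 : ℝ) < c := by rw [hcR]; exact add_pos haR hbR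
  have hcne : (c : ℝ) ≠ 0 := hcpos.ne'
  have hCpos : (0 : ℝ) < C := by exact_mod_cast hC0
  have hCne : (C : ℝ) ≠ 0 := hCpos.ne'
  -- the balance coordinate of `(A, B, C)` is `A/C = (d/c)² = (1 - 2t)²` for `t = a/c`
  have hdR : (d : ℝ) = 2 * a - c := by
    have h1 : (b : ℝ) + d = a := by exact_mod_cast hd
    linarith
  have hcoordR : (A : ℝ) * (c : ℝ) ^ 2 = C * (d : ℝ) ^ 2 := by exact_mod_cast hcoord
  have hkey : (A : ℝ) / (C : ℝ) = (1 - 2 * ((a : ℝ) / (c : ℝ))) ^ 2 := by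
    have h1 : (1 - 2 * ((a : ℝ) / (c : ℝ))) ^ 2 = (d : ℝ) ^ 2 / (c : ℝ) ^ 2 := by
      rw [hdR]
      field_simp
      ring
    rw [h1, div_eq_div_iff hCne (pow_ne_zero 2 hcne)]
    linear_combination hcoordR
  have hmem : ((A : ℕ) : ℝ) / ((C : ℕ) : ℝ) ∈ T := by
    rw [hkey]
    exact ht
  have hmain := H A B C hT hmem
  -- radicals: `rad(ABC) ≤ 2c · rad(abc)`
  have hr0 : 0 < rad a b c := Nat.radical_pos _
  have hrpos : (0 : ℝ) < ((rad a b c : ℕ) : ℝ) := by exact_mod_cast hr0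
  have hrS0 : 0 < rad A B C := Nat.radical_pos _
  have hrSpos : (0 : ℝ) < ((rad A B C : ℕ) : ℝ) := by exact_mod_cast hrS0
  have hradle : ((rad A B C : ℕ) : ℝ) ≤ 2 * (c : ℝ) * ((rad a b c : ℕ) : ℝ) := by
    exact_mod_cast hrad
  have hlogS : Real.log ((rad A B C : ℕ) : ℝ)
      ≤ Real.log 2 + Real.log c + Real.log ((rad a b c : ℕ) : ℝ) := by
    have h := Real.log_le_log hrSpos hradle
    rwa [Real.log_mul (by positivity) hrpos.ne', Real.log_mul (by norm_num) hcpos.ne'] at h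
  -- top: `c² ≤ 4C`, so `2 log c ≤ 2 log 2 + log C`
  have hCR : (c : ℝ) ^ 2 ≤ 4 * (C : ℝ) := by exact_mod_cast hC
  have hlog4 : Real.log (4 : ℝ) = 2 * Real.log 2 := by
    rw [show (4 : ℝ) = 2 ^ 2 by norm_num, Real.log_pow]
    norm_num
  have hlogC : 2 * Real.log (c : ℝ) ≤ 2 * Real.log 2 + Real.log (C : ℝ) := by
    have h := Real.log_le_log (by positivity) hCR
    rw [Real.log_pow, Real.log_mul (by norm_num) hCne, hlog4] at h
    push_cast at h
    linarith
  -- `2 log c - 2 log 2 ≤ K' + (1+δ)(log 2 + log c + log rad)`, i.e.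
  -- `log c ≤ (K' + (3+δ) log 2)/(1-δ) + ((1+δ)/(1-δ)) · log rad`
  have hkey2 := mul_le_mul_of_nonneg_left hlogS h1p
  have hcore : Real.log (c : ℝ)
      ≤ (K' + (3 + δ) * Real.log 2) / (1 - δ)
        + (1 + δ) / (1 - δ) * Real.log ((rad a b c : ℕ) : ℝ) := by
    rw [div_mul_eq_mul_div, ← add_div, le_div_iff₀ h1m]
    linarith
  -- slope `(1+δ)/(1-δ) = 1 + ε`, constant `≤ 2K' + 5`
  rw [hratio] at hcore
  linarith

/-- **Transport along the fold, case `b < a`.** With `d = a - b > 0` the fold data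
(`thinWindowFold_data`) feed `thinWindowFold_of_data`. [folklore] -/
theorem thinWindowFold_core {T : Set ℝ} {ε δ K' : ℝ} (hε : 0 < ε) (hε1 : ε ≤ 1)
    (hδ : δ = ε / (2 + ε)) (hK' : 0 ≤ K')
    (H : ∀ a b c : ℕ, IsABCTriple a b c → (a : ℝ) / (c : ℝ) ∈ T →
      Real.log (c : ℝ) ≤ K' + (1 + δ) * Real.log ((rad a b c : ℕ) : ℝ))
    {a b c : ℕ} (h : IsABCTriple a b c) (hba : b < a)
    (ht : (1 - 2 * ((a : ℝ) / (c : ℝ))) ^ 2 ∈ T) :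
    Real.log (c : ℝ) ≤ 2 * K' + 5 + (1 + ε) * Real.log ((rad a b c : ℕ) : ℝ) := by
  obtain ⟨A, B, C, hT, hcoord, hC, hrad⟩ :=
    thinWindowFold_data h (Nat.add_sub_of_le hba.le) (Nat.sub_pos_of_lt hba)
  exact thinWindowFold_of_data hε hε1 hδ hK' H h (Nat.add_sub_of_le hba.le) hT hcoord hC hrad ht

/-- **Transport along the fold `(a, b, c) ↦ ((a-b)², 4ab, c²)`** (all three divided by `4` when
`c` is even). If the logarithmic abc bound `log c ≤ K' + (1+δ) · log rad(abc)` with `δ = ε/(2+ε)`,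
`K' ≥ 0`, `0 < ε ≤ 1` holds for every abc triple with balance coordinate `a/c ∈ T`, then
`log c ≤ 2K' + 5 + (1+ε) · log rad(abc)` holds for every abc triple with `a/c ≠ 1/2` and
`(1 - 2a/c)² ∈ T`: for `b < a` this is `thinWindowFold_core` (the fold triple has coordinate
`(1 - 2a/c)²`, top `≥ c²/4` and radical `≤ 2c · rad(abc)`); for `a < b` apply it to the swapped
triple `(b, a, c)` (`b/c = 1 - a/c`, `(1 - 2(1-t))² = (1-2t)²`, `rad(bac) = rad(abc)`); `a = b`
would force `a/c = 1/2`. [folklore] -/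
theorem stub_thinWindowFold {T : Set ℝ} {ε δ K' : ℝ} (hε : 0 < ε) (hε1 : ε ≤ 1)
    (hδ : δ = ε / (2 + ε)) (hK' : 0 ≤ K')
    (H : ∀ a b c : ℕ, IsABCTriple a b c → (a : ℝ) / (c : ℝ) ∈ T →
      Real.log (c : ℝ) ≤ K' + (1 + δ) * Real.log ((rad a b c : ℕ) : ℝ)) :
    ∀ a b c : ℕ, IsABCTriple a b c →
      (a : ℝ) / (c : ℝ) ∈ {t : ℝ | t ≠ 1 / 2 ∧ (1 - 2 * t) ^ 2 ∈ T} →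
        Real.log (c : ℝ) ≤ 2 * K' + 5 + (1 + ε) * Real.log ((rad a b c : ℕ) : ℝ) := by
  intro a b c h ht
  simp only [Set.mem_setOf_eq] at ht
  obtain ⟨ht1, ht2⟩ := ht
  -- `c = a + b > 0`, so `(c : ℝ) ≠ 0`
  have habc : a + b = c := h.2.2.1
  have hc : (c : ℝ) ≠ 0 := by
    have ha : 0 < a := h.1
    have hc0 : 0 < c := by omega
    exact_mod_cast hc0.ne'
  have hcR : (c : ℝ) = a + b := by exact_mod_cast habc.symm
  rcases lt_trichotomy b a with hba | hab | hab
  · exact thinWindowFold_core hε hε1 hδ hK' H h hba ht2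
  · -- `a = b` forces `a/c = 1/2`
    exfalso
    apply ht1
    have habR : (b : ℝ) = a := by exact_mod_cast hab
    rw [div_eq_div_iff hc two_ne_zero]
    linarith
  · -- `a < b`: fold the swapped triple `(b, a, c)`, whose coordinate is `b/c = 1 - a/c`
    have hcoord : (1 - 2 * ((b : ℝ) / (c : ℝ))) ^ 2 = (1 - 2 * ((a : ℝ) / (c : ℝ))) ^ 2 := by
      have hbc : (b : ℝ) / (c : ℝ) = 1 - (a : ℝ) / (c : ℝ) := by
        rw [eq_sub_iff_add_eq, ← add_div, div_eq_one_iff_eq hc]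
        linarith
      rw [hbc]
      ring
    have hmem : (1 - 2 * ((b : ℝ) / (c : ℝ))) ^ 2 ∈ T := by
      rw [hcoord]
      exact ht2
    have key := thinWindowFold_core hε hε1 hδ hK' H h.swap hab hmem
    rwa [rad_swap] at key

end Summit.ABC.ABC.Theorems

end
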